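import Mathlib
import Summits.KontsevichZagierPeriods.Zeta5Search.SecondOrderTypes
import HarnessLib

/-!
# ζ(5) search — a COMPUTABLE MIRROR of the type functionals `typeRho / typeW / typeV / typeW2 / typeV2 / typeTauW / typeTauV`

Cell `pub-zeta5` (HONEST FRAMING: systematic search; no irrationality claim unless certified), prover seat p3 generation 3.
The type data `ρ^T_{i,σ}` of `LevelClassDigits` is a power-series coefficient (`PowerSeries.coeff` of a product of `binomSeries`), hence
`noncomputable`; the ORIGIN record windows of the type-space law (`ResidueLaw.RecWindowM12/M28`, law `typeSpaceLawOrigin_holds`) need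
finitely many EXPLICIT rational identities between values of `typeW/typeV/typeTauW/typeTauV` on explicit type lists (census g21 §25.3:
the doubled orbit points of each window lie on one affine line).  This file supplies the evaluation: a list-based truncated product
`prodCL` with `(prodCL K fs)[k] = coeff k (∏ mk f)` (`getD_prodCL`), the generalized binomial coefficient `rchoose r j = Ring.choose r j`
over `ℚ` (`choose_eq_rchoose`), and `typeRho_eq_typeRhoC : typeRho L e i σ = typeRhoC L e i σ` with `typeRhoC` computable, so that
`unfold typeW; simp only [typeRho_eq_typeRhoC]; decide +kernel` evaluates any type functional on an explicit type.
Pure bookkeeping of rational numbers; nothing here bears on irrationality.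
-/

open Finset PowerSeries Polynomial

namespace Summit.KontsevichZagierPeriods.Zeta5Search.TypeEval

open Summit.KontsevichZagierPeriods.Zeta5Search.ClusterValuation (binomSeries)
open Summit.KontsevichZagierPeriods.Zeta5Search.LevelClass (typeRho)

/-! ## §1 Generalized binomial coefficients over `ℚ`, computably -/

/-- `rchoose r j = C(r, j)` by the recursion `C(r, 0) = 1`, `C(r, j+1) = C(r, j)·(r − j)/(j + 1)`. -/
def rchoose (r : ℚ) : ℕ → ℚ
  | 0 => 1
  | j + 1 => rchoose r j * (r - j) / (j + 1)

/-- `Ring.choose r n = (descPochhammer ℚ n)(r) / n!` over `ℚ`. -/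
theorem choose_eq_desc_div (r : ℚ) (n : ℕ) : Ring.choose r n = (descPochhammer ℚ n).eval r / (n.factorial : ℚ) := by
  rw [Ring.choose_eq_smul, ← aeval_eq_smeval, aeval_def, ← eval_map, descPochhammer_map, smul_eq_mul, div_eq_inv_mul]

/-- **`Ring.choose r j = rchoose r j`** for `r : ℚ`. -/
theorem choose_eq_rchoose (r : ℚ) : ∀ j : ℕ, Ring.choose r j = rchoose r j
  | 0 => by rw [Ring.choose_zero_right]; rfl
  | j + 1 => by
      rw [rchoose, ← choose_eq_rchoose r j, choose_eq_desc_div, choose_eq_desc_div, descPochhammer_succ_eval,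
        Nat.factorial_succ]
      have hj : ((j.factorial : ℕ) : ℚ) ≠ 0 := by exact_mod_cast (Nat.factorial_ne_zero j)
      have hj1 : ((j : ℚ) + 1) ≠ 0 := by positivity
      push_cast
      field_simp

/-- Coefficient `j` of `(δ + ε)^e` (`e ∈ ℤ`, `δ ≠ 0`), computably: `C(e, j)·δ^{e−j}`. -/
def binomC (δ : ℚ) (e : ℤ) (j : ℕ) : ℚ := rchoose (e : ℚ) j * δ ^ (e - (j : ℤ))

/-- `binomSeries δ e = mk (binomC δ e)`. -/
theorem binomSeries_eq_mk (δ : ℚ) (e : ℤ) : binomSeries δ e = PowerSeries.mk (binomC δ e) := by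
  unfold binomSeries binomC
  congr 1
  funext j
  rw [choose_eq_rchoose]

/-! ## §2 Truncated products as lists -/

/-- Multiply the truncated coefficient list `g` (degrees `0..K`) by the series with coefficient function `f`, truncating at `K`. -/
def mulC (K : ℕ) (f : ℕ → ℚ) (g : List ℚ) : List ℚ :=
  (List.range (K + 1)).map fun k => ∑ i ∈ range (k + 1), f i * g.getD (k - i) 0

/-- Truncated (degrees `0..K`) coefficient list of the product of the series with coefficient functions `fs`. -/
def prodCL (K : ℕ) : List (ℕ → ℚ) → List ℚ
  | [] => (List.range (K + 1)).map fun k => if k = 0 then 1 else 0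
  | f :: fs => mulC K f (prodCL K fs)

/-- Entry `k ≤ K` of `(List.range (K+1)).map h` is `h k`. -/
theorem getD_map_range {K k : ℕ} (hk : k ≤ K) (h : ℕ → ℚ) : ((List.range (K + 1)).map h).getD k 0 = h k := by
  rw [List.getD_eq_getElem?_getD, List.getElem?_map, List.getElem?_range (by omega)]
  rfl

/-- **`(prodCL K fs)[k] = coeff k (∏_{f ∈ fs} mk f)`** for `k ≤ K`. -/
theorem getD_prodCL (K : ℕ) : ∀ (fs : List (ℕ → ℚ)) {k : ℕ}, k ≤ K →
    (prodCL K fs).getD k 0 = coeff k (fs.map fun f => PowerSeries.mk f).prod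
  | [], k, hk => by
      rw [prodCL, getD_map_range hk, List.map_nil, List.prod_nil, PowerSeries.coeff_one]
  | f :: fs, k, hk => by
      rw [prodCL, mulC, getD_map_range hk, List.map_cons, List.prod_cons, PowerSeries.coeff_mul,
        Finset.Nat.sum_antidiagonal_eq_sum_range_succ_mk]
      refine sum_congr rfl fun i hi => ?_
      have hi' : i ≤ k := Nat.lt_succ_iff.1 (mem_range.1 hi)
      rw [coeff_mk, getD_prodCL K fs (by omega)]

/-! ## §3 The computable `ρ` -/

/-- **Computable `ρ^T_{i,σ}`**: entry `n_i − σ` of the truncated product of the `(i − j + ε)^{e_j}`, `j ≤ L`, `j ≠ i`. -/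
def typeRhoC (L : ℕ) (e : ℕ → ℤ) (i σ : ℕ) : ℚ :=
  (prodCL ((-e i).toNat - σ) (((List.range (L + 1)).filter fun j => j ≠ i).map fun j : ℕ => binomC ((i : ℚ) - (j : ℚ)) (e j))).getD
    ((-e i).toNat - σ) 0

/-- **`typeRho = typeRhoC`.** -/
theorem typeRho_eq_typeRhoC (L : ℕ) (e : ℕ → ℤ) (i σ : ℕ) : typeRho L e i σ = typeRhoC L e i σ := by
  unfold typeRho typeRhoC
  rw [getD_prodCL _ _ le_rfl, List.map_map]
  congr 1
  have hs : (range (L + 1)).erase i = ((List.range (L + 1)).filter fun j => j ≠ i).toFinset := by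
    rw [List.toFinset_filter, List.toFinset_range, ← Finset.filter_ne']
    congr 1; funext j; simp
  rw [hs, List.prod_toFinset _ ((List.nodup_range).filter _)]
  congr 1
  refine List.map_congr_left fun j _ => ?_
  simp only [Function.comp_apply, binomSeries_eq_mk]

end Summit.KontsevichZagierPeriods.Zeta5Search.TypeEval
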